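import Summits.ValiantsHypothesis.ValiantsHypothesis.Theorems.NcUniqueParseTree
import HarnessLib

/-!
# UPT circuits: the interval-flattening rank bound and the `LID_r` lower bound

MODEL: UPT = normal-form UPT circuits typed by a shape (LLS18 Prop 7); the normal-form
conversion (poly blow-up in print) is NOT formalised (predicates of `NcUniqueParseTree`).
RANK BOUND `upt_rank_le` (LLS18 Lemma 9): at a node `π₀` with ≥ 2 leaves, the flattening
`ivFlat (off π₀) |T_{π₀}| b` of the output (rows = contexts outside the interval below `π₀`,
columns = interval contents; `ivFlat p m p` is `NcSkewPermanent.outerFlat p m`) has rank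
≤ size: every row lies in the span of the body rows (pattern of `rank_outerFlat_le`).
LOWER BOUND `lidPoly_upt`: a typed circuit computing `LID_r` (`r ≥ 1`) has size `≥ 2^{r+1}`:
homogeneity forces `|T| = 4r`, the halving walk gives a node with `r < ℓ ≤ 2r` leaves, and
along any interval of length `ℓ ≤ 2r` the flattening of `LID_r` has rank `≥ 2^ℓ`, by the
explicit selector `uptSel` (one periodic completion per content; `uptSel · ivFlat = 1`,
pattern of `outerFlat_lidPoly_mul_transpose` with a selector instead of the transpose).
-/

noncomputable section

namespace Summit.ValiantsHypothesis.ValiantsHypothesis.Theorems.NcUniqueParseTreeRank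

set_option linter.dupNamespace false

open Literature.Computability.AlgebraicComplexity
  Literature.Computability.AlgebraicComplexity.ArithCircuit
  Summit.ValiantsHypothesis.ValiantsHypothesis.Theorems.NcAutomatonIntersection
  Summit.ValiantsHypothesis.ValiantsHypothesis.Theorems.NcCentralWidth
  Summit.ValiantsHypothesis.ValiantsHypothesis.Theorems.NcSOSDegreeFour
  Summit.ValiantsHypothesis.ValiantsHypothesis.Theorems.NcBlockForms
  Summit.ValiantsHypothesis.ValiantsHypothesis.Theorems.NcSkewPermanent
  Summit.ValiantsHypothesis.ValiantsHypothesis.Theorems.NcPalindromePower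
  Summit.ValiantsHypothesis.ValiantsHypothesis.Theorems.NcUniqueParseTree

universe u v

/-- The halving walk: below more than `m ≥ 1` leaves there is a node with `m / 2 < #leaves ≤ m`.
[cite: LagardeLimayeSrinivasan2018, §3 Theorem 10] -/
theorem exists_sub_size {m : ℕ} (hm : 1 ≤ m) : ∀ T : Shape, m < T.size →
    ∃ (π : List Bool) (S : Shape), T.sub π = some S ∧ S.size ≤ m ∧ m < 2 * S.size
  | .leaf, h => by exfalso; simp only [Shape.size] at h; omega
  | .node l r, h => by
    simp only [Shape.size] at h
    by_cases hl : m < l.size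
    · obtain ⟨π, S, hS, h1, h2⟩ := exists_sub_size hm l hl
      exact ⟨false :: π, S, hS, h1, h2⟩
    · by_cases hr : m < r.size
      · obtain ⟨π, S, hS, h1, h2⟩ := exists_sub_size hm r hr
        exact ⟨true :: π, S, hS, h1, h2⟩
      · by_cases hlr : r.size ≤ l.size
        · exact ⟨[false], l, Shape.sub_nil l, by omega, by omega⟩
        · exact ⟨[true], r, Shape.sub_nil r, by omega, by omega⟩

section Flat

variable (K : Type u) [Field K] {σ : Type v}

/-- The flattening of `f` along the interval `[a, a + ℓ)` of positions: rows = the context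
`(y₁, y₂)` outside the interval, columns = the interval content `A`, entry `[y₁ A y₂] f`
(LLS18's `M[f, Π]` up to transposition; `ivFlat p m p = outerFlat p m`).
[cite: LagardeLimayeSrinivasan2018, §3 Lemma 9] -/
def ivFlat (a ℓ b : ℕ) :
    FreeAlgebra K σ →ₗ[K] Matrix ((Fin a → σ) × (Fin b → σ)) (Fin ℓ → σ) K where
  toFun f := fun y A => coeff (List.ofFn y.1 ++ List.ofFn A ++ List.ofFn y.2) f
  map_add' f g := by funext y A; simp only [map_add]; rfl
  map_smul' c f := by funext y A; simp only [map_smul, smul_eq_mul, RingHom.id_apply]; rfl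

/-- [cite: LagardeLimayeSrinivasan2018, §3 Lemma 9] -/
theorem ivFlat_apply (a ℓ b : ℕ) (f : FreeAlgebra K σ) (y : (Fin a → σ) × (Fin b → σ))
    (A : Fin ℓ → σ) :
    ivFlat K a ℓ b f y A = coeff (List.ofFn y.1 ++ List.ofFn A ++ List.ofFn y.2) f := rfl

variable [DecidableEq σ]

/-- **Row lemma**: the row of a framed body `h · g · h̄` at context `(y₁, y₂)` is
`([y₁] h · [y₂] h̄) • (A ↦ [A] g)`. [cite: LagardeLimayeSrinivasan2018, §3 Lemma 9] -/
theorem ivFlat_framed_row {a ℓ b d : ℕ} (hd : a + ℓ + b ≤ d) {h g hb : FreeAlgebra K σ}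
    (hh : degPart d a h = h) (hg : degPart d ℓ g = g) (hhb : degPart d b hb = hb)
    (y : (Fin a → σ) × (Fin b → σ)) :
    ivFlat K a ℓ b (h * g * hb) y =
      (coeff (List.ofFn y.1) h * coeff (List.ofFn y.2) hb) • fun A => coeff (List.ofFn A) g := by
  funext A
  rw [Pi.smul_apply, smul_eq_mul, ivFlat_apply]
  have hhg : degPart d (a + ℓ) (h * g) = h * g := degPart_mul_of_eq hh hg (by omega)
  rw [coeff_append_mul (d := d) (a := a + ℓ) (b := b) (by omega) (List.ofFn y.1 ++ List.ofFn A)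
      (List.ofFn y.2) (by rw [List.length_append, List.length_ofFn, List.length_ofFn])
      List.length_ofFn hhg hhb,
    coeff_append_mul (d := d) (a := a) (b := ℓ) (by omega) (List.ofFn y.1) (List.ofFn A)
      List.length_ofFn List.length_ofFn hh hg]
  ring

/-- Every row of the flattening of a member of the UPT span lies in any submodule containing
the body column-functions `A ↦ [A] g`. [cite: LagardeLimayeSrinivasan2018, §3 Lemma 9] -/
theorem rows_mem_ivFlat {a ℓ b d : ℕ} (hd : a + ℓ + b ≤ d) {B : Set (FreeAlgebra K σ)}
    (hB : ∀ g ∈ B, degPart d ℓ g = g) {f : FreeAlgebra K σ} (hf : f ∈ uptSpan B d a b)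
    (W : Submodule K ((Fin ℓ → σ) → K)) (hW : ∀ g ∈ B, (fun A => coeff (List.ofFn A) g) ∈ W) :
    ∀ y, ivFlat K a ℓ b f y ∈ W := by
  unfold uptSpan at hf
  induction hf using Submodule.span_induction with
  | mem x hx =>
    obtain ⟨g, h, hb, hg, hh, hhb, rfl⟩ := hx
    intro y
    rw [ivFlat_framed_row K hd hh (hB g hg) hhb y]
    exact W.smul_mem _ (hW g hg)
  | zero => intro y; rw [map_zero]; exact W.zero_mem
  | add f g _ _ hf hg => intro y; rw [map_add]; exact W.add_mem (hf y) (hg y)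
  | smul c f _ hf => intro y; rw [map_smul]; exact W.smul_mem c (hf y)

variable [Fintype σ]

/-- **Rank bound, span form**: if the bodies are among `vals`, the flattening of a member of
the UPT span has rank `≤ |vals|` (pattern of `NcSkewPermanent.rank_outerFlat_le`).
[cite: LagardeLimayeSrinivasan2018, §3 Lemma 9] -/
theorem rank_ivFlat_le_of_mem {a ℓ b d : ℕ} (hd : a + ℓ + b ≤ d) (vals : List (FreeAlgebra K σ))
    {B : Set (FreeAlgebra K σ)} (hBv : ∀ g ∈ B, ∃ j, j < vals.length ∧ g = vals.getD j 0)
    (hB : ∀ g ∈ B, degPart d ℓ g = g) {f : FreeAlgebra K σ} (hf : f ∈ uptSpan B d a b) :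
    (ivFlat K a ℓ b f).rank ≤ vals.length := by
  classical
  let Φ : Fin vals.length → (Fin ℓ → σ) → K := fun j A => coeff (List.ofFn A) (vals.getD j.val 0)
  have hrows : ∀ y, ivFlat K a ℓ b f y ∈ Submodule.span K (Set.range Φ) := by
    refine rows_mem_ivFlat K hd hB hf _ fun g hg => ?_
    obtain ⟨j, hj, rfl⟩ := hBv g hg
    exact Submodule.subset_span ⟨⟨j, hj⟩, rfl⟩
  calc (ivFlat K a ℓ b f).rank
      = Module.finrank K (Submodule.span K (Set.range (ivFlat K a ℓ b f).row)) :=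
        Matrix.rank_eq_finrank_span_row _
    _ ≤ Module.finrank K (Submodule.span K (Set.range Φ)) := by
        apply Submodule.finrank_mono
        exact Submodule.span_le.2 (by rintro _ ⟨y, rfl⟩; exact hrows y)
    _ ≤ Fintype.card (Fin vals.length) := finrank_range_le_card (R := K) Φ
    _ = vals.length := Fintype.card_fin _

/-- **LAGARDE–MALOD–PERIFEL RANK BOUND in the kernel** (UPT = normal-form UPT circuits typed by
a shape (LLS18 Prop 7); the normal-form conversion (poly blow-up in print) is NOT formalised).
For every field, alphabet, shape `T`, typing and node `π₀` of `T` with at least two leaves: a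
typed circuit of shape `T` computing `f` has `rank (ivFlat (off π₀) |T_{π₀}| b f) ≤ size`,
where `off π₀ + |T_{π₀}| + b = |T|`.
[cite: LagardeLimayeSrinivasan2018, §3 Lemma 9] [cite: LagardeMalodPerifel2019, §3] -/
theorem upt_rank_le (P : ArithCircuit K σ) {T : Shape} {ty : ℕ → List Bool}
    (hg : ∀ k (hk : k < P.gates.length), GateTyped T ty (ty k) P.gates[k])
    (ho : OpTyped T ty [] P.output) {π₀ : List Bool} {S₀ : Shape} (hS₀ : T.sub π₀ = some S₀)
    (h2 : 2 ≤ S₀.size) {b : ℕ} (hb : T.off π₀ + S₀.size + b = T.size) :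
    (ivFlat K (T.off π₀) S₀.size b P.ncEval).rank ≤ P.size := by
  have hlen : (ncGateValues P.gates).length = P.gates.length := by
    simpa using (ncGateValues_append_getD P.gates []).1
  have hmem := output_mem_uptSpan P hg ho hS₀ h2
  rw [show T.size - (T.off π₀ + S₀.size) = b by omega] at hmem
  have h := rank_ivFlat_le_of_mem K (ℓ := S₀.size) (d := T.size) (by omega) (ncGateValues P.gates)
    (B := tyBodies P.gates ty π₀) (fun g ⟨j, hj, _, hgj⟩ => ⟨j, by omega, hgj⟩)
    (fun g ⟨j, hj, hty, hgj⟩ => by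
      rw [hgj]
      exact (typed_hom P.gates hg j hj).2 S₀ (by rw [hty]; exact hS₀)) hmem
  rw [hlen] at h
  exact h

end Flat

section LID

variable (K : Type u) [Field K]

/-- The `2r`-periodic word of length `4r` with period `e`. [cite: HrubesWigdersonYehudayoff2010] -/
def perFn (r : ℕ) (e : Fin (2 * r) → Fin 2) : Fin (4 * r) → Fin 2 :=
  fun p => e ⟨p.val % (2 * r), Nat.mod_lt _ (by have := p.isLt; omega)⟩

/-- [cite: HrubesWigdersonYehudayoff2010, Cor. C.4] -/
theorem lidPoly_eq_sum (r : ℕ) :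
    lidPoly K r =
      ∑ e : Fin (2 * r) → Fin 2, ((List.ofFn (perFn r e)).map (FreeAlgebra.ι K)).prod := rfl

/-- [cite: HrubesWigdersonYehudayoff2010, Cor. C.4] -/
theorem ofFn_perFn (r : ℕ) (e : Fin (2 * r) → Fin 2) :
    List.ofFn (perFn r e) = List.ofFn e ++ List.ofFn e := ofFn_periodic r e

/-- `LID_r ≠ 0` (its outer flattening has rank `4^r`). [cite: LimayeMalodSrinivasan2016, §5] -/
theorem lidPoly_ne_zero (r : ℕ) : lidPoly K r ≠ 0 := fun h => by
  have h1 := rank_outerFlat_lidPoly K r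
  rw [h, map_zero, Matrix.rank_zero] at h1
  exact pow_ne_zero r (by norm_num) h1.symm

/-- `LID_r` has no part of total degree `d ≠ 4r`. [cite: HrubesWigdersonYehudayoff2010, C.4] -/
theorem degPart_self_lidPoly {r d : ℕ} (hd : d ≠ 4 * r) : degPart d d (lidPoly K r) = 0 := by
  rw [lidPoly_eq_sum, map_sum]
  exact Finset.sum_eq_zero fun e _ => by
    rw [degPart_word le_rfl, if_neg (by rw [List.length_ofFn]; omega)]

/-- Letter `t` of the periodic word `e e` (junk `0` beyond `4r`).
[cite: LimayeMalodSrinivasan2016, §5] -/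
def perVal (r : ℕ) (e : Fin (2 * r) → Fin 2) (t : ℕ) : Fin 2 :=
  if h : t < 2 * r then e ⟨t, h⟩ else if h' : t - 2 * r < 2 * r then e ⟨t - 2 * r, h'⟩ else 0

/-- The period whose periodic word carries the content `A` on the interval `[a, a + ℓ)` and
`0` at every position not congruent to the interval. [cite: LimayeMalodSrinivasan2016, §5] -/
def baseOf (r a ℓ : ℕ) (A : Fin ℓ → Fin 2) : Fin (2 * r) → Fin 2 := fun ρ =>
  if h : a ≤ ρ.val ∧ ρ.val < a + ℓ then A ⟨ρ.val - a, by omega⟩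
  else if h' : a ≤ ρ.val + 2 * r ∧ ρ.val + 2 * r < a + ℓ then A ⟨ρ.val + 2 * r - a, by omega⟩
  else 0

/-- The selected row of a content `A`: the context of the periodic completion of `A`.
[cite: LimayeMalodSrinivasan2016, §5] -/
def rowOf (r a ℓ b : ℕ) (A : Fin ℓ → Fin 2) : (Fin a → Fin 2) × (Fin b → Fin 2) :=
  (fun t => perVal r (baseOf r a ℓ A) t.val, fun j => perVal r (baseOf r a ℓ A) (a + ℓ + j.val))

/-- [cite: LimayeMalodSrinivasan2016, §5] -/
theorem getElem_ofFn_append_self {r : ℕ} (e : Fin (2 * r) → Fin 2) (t : ℕ)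
    (ht : t < (List.ofFn e ++ List.ofFn e).length) :
    (List.ofFn e ++ List.ofFn e)[t] = perVal r e t := by
  have h4 : t < 4 * r := by rw [List.length_append, List.length_ofFn] at ht; omega
  unfold perVal
  by_cases h : t < 2 * r
  · rw [dif_pos h, List.getElem_append_left (by rw [List.length_ofFn]; exact h), List.getElem_ofFn]
  · rw [dif_neg h, dif_pos (show t - 2 * r < 2 * r by omega),
      List.getElem_append_right (by rw [List.length_ofFn]; omega), List.getElem_ofFn]
    exact congrArg e (Fin.ext (show t - (List.ofFn e).length = t - 2 * r by rw [List.length_ofFn]))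

/-- Letters of a framed word `y₁ A' y₂`. [cite: LimayeMalodSrinivasan2016, §5] -/
theorem getElem_frame {a ℓ b : ℕ} (y1 : Fin a → Fin 2) (A' : Fin ℓ → Fin 2) (y2 : Fin b → Fin 2)
    (t : ℕ) (ht : t < (List.ofFn y1 ++ List.ofFn A' ++ List.ofFn y2).length) :
    (List.ofFn y1 ++ List.ofFn A' ++ List.ofFn y2)[t] =
      if h : t < a then y1 ⟨t, h⟩ else if h' : t < a + ℓ then A' ⟨t - a, by omega⟩
      else y2 ⟨t - (a + ℓ), by
        rw [List.length_append, List.length_append, List.length_ofFn, List.length_ofFn,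
          List.length_ofFn] at ht; omega⟩ := by
  by_cases h : t < a
  · rw [dif_pos h, List.getElem_append_left (by
        rw [List.length_append, List.length_ofFn, List.length_ofFn]; omega),
      List.getElem_append_left (by rw [List.length_ofFn]; omega), List.getElem_ofFn]
  · rw [dif_neg h]
    by_cases h' : t < a + ℓ
    · rw [dif_pos h', List.getElem_append_left (by
          rw [List.length_append, List.length_ofFn, List.length_ofFn]; omega),
        List.getElem_append_right (by rw [List.length_ofFn]; omega), List.getElem_ofFn]
      exact congrArg A' (Fin.ext (show t - (List.ofFn y1).length = t - a by rw [List.length_ofFn]))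
    · rw [dif_neg h', List.getElem_append_right (by
          rw [List.length_append, List.length_ofFn, List.length_ofFn]; omega), List.getElem_ofFn]
      exact congrArg y2 (Fin.ext (show t - (List.ofFn y1 ++ List.ofFn A').length = t - (a + ℓ) by
        rw [List.length_append, List.length_ofFn, List.length_ofFn]))

/-- On the interval, the completion of `A` reads `A`. [cite: LimayeMalodSrinivasan2016, §5] -/
theorem perVal_baseOf_of_mem {r a ℓ : ℕ} (hℓ : ℓ ≤ 2 * r) (haℓ : a + ℓ ≤ 4 * r) (A : Fin ℓ → Fin 2)
    {t : ℕ} (h1 : a ≤ t) (h2 : t < a + ℓ) :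
    perVal r (baseOf r a ℓ A) t = A ⟨t - a, by omega⟩ := by
  by_cases ht : t < 2 * r
  · have e1 : perVal r (baseOf r a ℓ A) t = baseOf r a ℓ A ⟨t, ht⟩ := by rw [perVal, dif_pos ht]
    rw [e1]
    dsimp only [baseOf]
    rw [dif_pos (show a ≤ t ∧ t < a + ℓ from ⟨h1, h2⟩)]
  · have h3 : t - 2 * r < 2 * r := by omega
    have e1 : perVal r (baseOf r a ℓ A) t = baseOf r a ℓ A ⟨t - 2 * r, h3⟩ := by
      rw [perVal, dif_neg ht, dif_pos h3]
    rw [e1]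
    dsimp only [baseOf]
    rw [dif_neg (show ¬(a ≤ t - 2 * r ∧ t - 2 * r < a + ℓ) by omega),
      dif_pos (show a ≤ t - 2 * r + 2 * r ∧ t - 2 * r + 2 * r < a + ℓ by omega)]
    exact congrArg A (Fin.ext (show t - 2 * r + 2 * r - a = t - a by omega))

/-- The periodic word reads its period at `ρ` and `ρ + 2r`. [cite: LimayeMalodSrinivasan2016] -/
theorem perVal_period {r : ℕ} (e : Fin (2 * r) → Fin 2) (ρ : Fin (2 * r)) :
    perVal r e ρ.val = e ρ ∧ perVal r e (ρ.val + 2 * r) = e ρ := by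
  have hρ := ρ.isLt
  unfold perVal
  rw [dif_pos hρ, dif_neg (show ¬(ρ.val + 2 * r < 2 * r) by omega),
    dif_pos (show ρ.val + 2 * r - 2 * r < 2 * r by omega)]
  exact ⟨rfl, congrArg e (Fin.ext (show ρ.val + 2 * r - 2 * r = ρ.val by omega))⟩

/-- **Selector rows**: the periodic word `e e` has context `rowOf A` and content `A'` along
`[a, a + ℓ)` (`ℓ ≤ 2r`) iff `A' = A` and `e` is the completion period of `A`.
[cite: LimayeMalodSrinivasan2016, §5] -/
theorem glue_rowOf_eq_iff {r a ℓ b : ℕ} (hb : a + ℓ + b = 4 * r) (hℓ : ℓ ≤ 2 * r)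
    (A A' : Fin ℓ → Fin 2) (e : Fin (2 * r) → Fin 2) :
    List.ofFn e ++ List.ofFn e =
        List.ofFn (rowOf r a ℓ b A).1 ++ List.ofFn A' ++ List.ofFn (rowOf r a ℓ b A).2 ↔
      A' = A ∧ e = baseOf r a ℓ A := by
  have hL : (List.ofFn e ++ List.ofFn e).length = 4 * r := by
    rw [List.length_append, List.length_ofFn]; omega
  have hR : (List.ofFn (rowOf r a ℓ b A).1 ++ List.ofFn A' ++ List.ofFn (rowOf r a ℓ b A).2).length
      = 4 * r := by
    rw [List.length_append, List.length_append, List.length_ofFn, List.length_ofFn,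
      List.length_ofFn]; omega
  -- letter `t` of the right-hand side outside the interval is `perVal r (baseOf A) t`
  have hout : ∀ t (ht : t < 4 * r), ¬(a ≤ t ∧ t < a + ℓ) →
      (List.ofFn (rowOf r a ℓ b A).1 ++ List.ofFn A' ++ List.ofFn (rowOf r a ℓ b A).2)[t]'
        (by omega) = perVal r (baseOf r a ℓ A) t := by
    intro t ht hn
    rw [getElem_frame]
    by_cases h : t < a
    · rw [dif_pos h]; rfl
    · rw [dif_neg h, dif_neg (show ¬(t < a + ℓ) by omega)]
      show perVal r (baseOf r a ℓ A) (a + ℓ + (t - (a + ℓ))) = _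
      rw [show a + ℓ + (t - (a + ℓ)) = t by omega]
  constructor
  · intro H
    have he : e = baseOf r a ℓ A := by
      funext ρ
      have hρ := ρ.isLt
      obtain ⟨hρ1, hρ2⟩ := perVal_period e ρ
      obtain ⟨hβ1, hβ2⟩ := perVal_period (baseOf r a ℓ A) ρ
      by_cases hin : a ≤ ρ.val ∧ ρ.val < a + ℓ
      · have h1 := List.getElem_of_eq H
          (show ρ.val + 2 * r < (List.ofFn e ++ List.ofFn e).length by omega)
        rw [getElem_ofFn_append_self, hρ2, hout (ρ.val + 2 * r) (by omega) (by omega), hβ2] at h1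
        exact h1
      · have h1 := List.getElem_of_eq H (show ρ.val < (List.ofFn e ++ List.ofFn e).length by omega)
        rw [getElem_ofFn_append_self, hρ1, hout ρ.val (by omega) hin, hβ1] at h1
        exact h1
    refine ⟨funext fun i => ?_, he⟩
    have hi := i.isLt
    have h1 := List.getElem_of_eq H (show a + i.val < (List.ofFn e ++ List.ofFn e).length by omega)
    rw [getElem_ofFn_append_self, getElem_frame, dif_neg (show ¬(a + i.val < a) by omega),
      dif_pos (show a + i.val < a + ℓ by omega)] at h1
    have h2 := perVal_baseOf_of_mem (a := a) (t := a + i.val) hℓ (by omega) A (by omega) (by omega)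
    rw [← he, h1] at h2
    have hi' : (⟨a + i.val - a, by omega⟩ : Fin ℓ) = i :=
      Fin.ext (show a + i.val - a = i.val by omega)
    rw [hi'] at h2
    exact h2
  · rintro ⟨rfl, rfl⟩
    refine List.ext_getElem (by rw [hL, hR]) fun t h₁ h₂ => ?_
    have h4 : t < 4 * r := by omega
    rw [getElem_ofFn_append_self]
    by_cases hin : a ≤ t ∧ t < a + ℓ
    · rw [perVal_baseOf_of_mem hℓ (show a + ℓ ≤ 4 * r by omega) _ hin.1 hin.2, getElem_frame,
        dif_neg (show ¬(t < a) by omega), dif_pos hin.2]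
    · exact (hout t h4 hin).symm

/-- The `rowOf A`-row of the interval flattening of `LID_r` is the indicator of `A`.
[cite: LimayeMalodSrinivasan2016, §5] [cite: LagardeLimayeSrinivasan2018, §3 Theorem 10] -/
theorem ivFlat_lidPoly_rowOf {r a ℓ b : ℕ} (hb : a + ℓ + b = 4 * r) (hℓ : ℓ ≤ 2 * r)
    (A A' : Fin ℓ → Fin 2) :
    ivFlat K a ℓ b (lidPoly K r) (rowOf r a ℓ b A) A' = if A' = A then 1 else 0 := by
  rw [ivFlat_apply, lidPoly_eq_sum, map_sum]
  simp only [ofFn_perFn, coeff_word, glue_rowOf_eq_iff hb hℓ]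
  by_cases hA : A' = A
  · rw [if_pos hA]
    simp only [hA, true_and, Finset.sum_ite_eq', Finset.mem_univ, if_true]
  · rw [if_neg hA]
    simp only [hA, false_and, if_false, Finset.sum_const_zero]

/-- The selector matrix: row `A` picks the context `rowOf A`. [cite: LimayeMalodSrinivasan2016] -/
def uptSel (r a ℓ b : ℕ) : Matrix (Fin ℓ → Fin 2) ((Fin a → Fin 2) × (Fin b → Fin 2)) K :=
  fun A y => if y = rowOf r a ℓ b A then 1 else 0

/-- `uptSel · ivFlat (LID_r) = 1` along any interval of length `ℓ ≤ 2r`.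
[cite: LimayeMalodSrinivasan2016, §5] [cite: LagardeLimayeSrinivasan2018, §3 Theorem 10] -/
theorem uptSel_mul_ivFlat {r a ℓ b : ℕ} (hb : a + ℓ + b = 4 * r) (hℓ : ℓ ≤ 2 * r) :
    uptSel K r a ℓ b * ivFlat K a ℓ b (lidPoly K r) = 1 := by
  ext A A'
  rw [Matrix.mul_apply, Matrix.one_apply]
  simp only [uptSel, ite_mul, one_mul, zero_mul, Finset.sum_ite_eq', Finset.mem_univ, if_true]
  rw [ivFlat_lidPoly_rowOf K hb hℓ]
  by_cases h : A = A'
  · rw [if_pos h, if_pos h.symm]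
  · rw [if_neg h, if_neg (Ne.symm h)]

/-- **Interval rank of `LID_r`**: along any interval of length `ℓ ≤ 2r` the flattening of
`LID_r` has rank `≥ 2^ℓ`. [cite: LagardeLimayeSrinivasan2018, §3 Theorem 10]
[cite: LimayeMalodSrinivasan2016, §5] -/
theorem le_rank_ivFlat_lidPoly {r a ℓ b : ℕ} (hb : a + ℓ + b = 4 * r) (hℓ : ℓ ≤ 2 * r) :
    2 ^ ℓ ≤ (ivFlat K a ℓ b (lidPoly K r)).rank := by
  have h := Matrix.rank_mul_le_right (uptSel K r a ℓ b) (ivFlat K a ℓ b (lidPoly K r))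
  rw [uptSel_mul_ivFlat K hb hℓ, Matrix.rank_one] at h
  simpa only [Fintype.card_fun, Fintype.card_fin] using h

/-- **`LID_r` IS EXPONENTIALLY HARD FOR UPT CIRCUITS** (UPT = normal-form UPT circuits typed by
a shape (LLS18 Prop 7); the normal-form conversion (poly blow-up in print) is NOT formalised):
every typed noncommutative circuit over `{z₀, z₁}` computing `LID_r` (`r ≥ 1`) has size
`≥ 2^{r+1}` — the shape has `4r` leaves, a node with `r < ℓ ≤ 2r` leaves exists, and there the
rank bound `≤ size` meets the interval rank `2^ℓ ≥ 2^{r+1}` of `LID_r`.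
[cite: LagardeLimayeSrinivasan2018, §3 Theorem 10] [cite: LagardeMalodPerifel2019, §3]
[cite: HrubesWigdersonYehudayoff2010, Cor. C.4] -/
theorem lidPoly_upt {r : ℕ} (hr : 1 ≤ r) (P : ArithCircuit K (Fin 2)) {T : Shape}
    {ty : ℕ → List Bool} (hg : ∀ k (hk : k < P.gates.length), GateTyped T ty (ty k) P.gates[k])
    (ho : OpTyped T ty [] P.output) (h : P.ncEval = lidPoly K r) : 2 ^ (r + 1) ≤ P.size := by
  have hlen : (ncGateValues P.gates).length = P.gates.length := by
    simpa using (ncGateValues_append_getD P.gates []).1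
  have hT : T.size = 4 * r := by
    by_contra hne
    have hdeg := (opTyped_hom ho (ncGateValues P.gates)
      (fun j hj => typed_hom P.gates hg j (by omega))).2 T (Shape.sub_nil T)
    rw [show P.output.ncEval (ncGateValues P.gates) = P.ncEval from rfl, h,
      degPart_self_lidPoly K hne] at hdeg
    exact lidPoly_ne_zero K r hdeg.symm
  obtain ⟨π₀, S₀, hS₀, h1, h2⟩ := exists_sub_size (m := 2 * r) (by omega) T (by omega)
  have hle := Shape.off_add_size_le hS₀
  have hrank := upt_rank_le K P hg ho hS₀ (by omega) (b := 4 * r - (T.off π₀ + S₀.size))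
    (by omega)
  rw [h] at hrank
  have hlow := le_rank_ivFlat_lidPoly K (r := r) (a := T.off π₀) (ℓ := S₀.size)
    (b := 4 * r - (T.off π₀ + S₀.size)) (by omega) (by omega)
  calc 2 ^ (r + 1) ≤ 2 ^ S₀.size := Nat.pow_le_pow_right (by norm_num) (by omega)
    _ ≤ P.size := hlow.trans hrank

end LID

end Summit.ValiantsHypothesis.ValiantsHypothesis.Theorems.NcUniqueParseTreeRank

end
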